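import Mathlib

/-!
# SoloBlind — null-chain weights: the first-order constraint sums vanish (session 8, paper §14.1)

Context (solo-blind programme on `ResolutionOfSingularities`, W-side, surface model BU₂): along a chain of
null points of an order-`p` automorphism of a smooth surface in characteristic `p`, the order-`p` condition
`δ^p = 0` constrains an unknown coefficient `λ` of weight `η` only through the sum
`Φ_η(t) = ∑_{k<p} ∏_{l<k} (t+l) · ∏_{k<l<p} (t+η+l)` (one summand per position of the letter among the `p`
factors).  Proposition 14.3 of the programme notes: `Φ_η ≡ 0` unless `η ∈ {0, 1}`; the mechanism is the
vanishing of high iterated finite differences of low-degree polynomials (Lemma 14.2).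

Proved here (sorry-free):
* `altChooseSum_eval_eq_zero` — Lemma 14.2: for a polynomial `P` over a commutative ring with
  `natDegree P < n` and any `y`, `∑_{k=0}^{n} (-1)^(n-k) C(n,k) • P(y+k) = 0`
  (Mathlib's `Polynomial.fwdDiff_iter_eq_zero_of_degree_lt` made explicit through
  `fwdDiff_iter_eq_sum_shift`);
* `altChooseSum_affine_eq_zero` — the case used for letters of `y`-degree one: `∑ (-1)^(n-k) C(n,k) (A + B k) = 0`
  for `n ≥ 2`;
* `Phi`, `Phi_three_eq_zero`, `Phi_five_eq_zero` — the position-weighted constraint sums vanish at every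
  point for `p = 3, 5` and every `η ∉ {0,1}`, and `Phi_five_ne_zero_of_eta_zero/one` — they do not for
  `η ∈ {0,1}` (for `η = 1` only through the position-dependent weight; kernel decision over `ZMod p`).
-/

namespace Summit.ResolutionOfSingularities.ResolutionOfSingularities.Theorems.SoloBlind

open Polynomial Finset

/-- Lemma 14.2 (finite differences): the `n`-th alternating binomial sum of the values of a polynomial of
degree `< n` on an arithmetic progression of step one vanishes. -/
theorem altChooseSum_eval_eq_zero {R : Type*} [CommRing R] (P : R[X]) {n : ℕ}
    (hP : P.natDegree < n) (y : R) :
    ∑ k ∈ range (n + 1), ((-1 : ℤ) ^ (n - k) * n.choose k) • P.eval (y + k) = 0 := by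
  have h := congrFun (Polynomial.fwdDiff_iter_eq_zero_of_degree_lt hP) y
  rw [fwdDiff_iter_eq_sum_shift] at h
  simpa using h

/-- The affine case (letters acting with a weight affine in the position): for `n ≥ 2`,
`∑_{k=0}^{n} (-1)^(n-k) C(n,k) (A + B k) = 0`. -/
theorem altChooseSum_affine_eq_zero {R : Type*} [CommRing R] (A B : R) {n : ℕ} (hn : 2 ≤ n) :
    ∑ k ∈ range (n + 1), ((-1 : ℤ) ^ (n - k) * n.choose k) • (A + B * k) = 0 := by
  have hP : (C B * X + C A).natDegree < n := lt_of_le_of_lt natDegree_linear_le (by omega)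
  have key : ∀ k : ℕ, A + B * (k : R) = (C B * X + C A).eval ((0 : R) + (k : R)) := by
    intro k; simp only [eval_add, eval_mul, eval_C, eval_X, zero_add]; ring
  simp_rw [key]
  exact altChooseSum_eval_eq_zero _ hP 0

/-- The first-order constraint sum with position weights `λ_k = a + b k`:
`Φ_η(t; a, b) = ∑_{k<p} (a + b k) ∏_{l<k}(t+l) · ∏_{k<l<p}(t+η+l)` over `ZMod p`
(for the letters of §14.1 the weight is affine in the position `k`: `λ_k = j + k` resp. `i + k m`). -/
def Phi (p : ℕ) (η t a b : ZMod p) : ZMod p :=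
  ∑ k ∈ range p, (a + b * (k : ZMod p)) *
    ((∏ l ∈ range k, (t + (l : ZMod p))) * ∏ l ∈ Ico (k + 1) p, (t + η + (l : ZMod p)))

/-- `p = 3`: the weighted constraint sum vanishes at every point for every `η ∉ {0, 1}` (i.e. `η = 2`). -/
theorem Phi_three_eq_zero : ∀ η t a b : ZMod 3, η ≠ 0 → η ≠ 1 → Phi 3 η t a b = 0 := by decide

/-- `p = 5`: the weighted constraint sum vanishes at every point for every `η ∉ {0, 1}`. -/
theorem Phi_five_eq_zero : ∀ η t a b : ZMod 5, η ≠ 0 → η ≠ 1 → Phi 5 η t a b = 0 := by decide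

/-- `p = 5`, `η = 0`: the constraint is not void (already with constant weights). -/
theorem Phi_five_ne_zero_of_eta_zero : ∃ t : ZMod 5, Phi 5 0 t 1 0 ≠ 0 := by decide

/-- `p = 5`, `η = 1`: the constraint is not void, but only through the position-dependent part of the weight
(with constant weights `Φ_1 ≡ 0`). -/
theorem Phi_five_ne_zero_of_eta_one : (∃ t : ZMod 5, Phi 5 1 t 0 1 ≠ 0) ∧ ∀ t a : ZMod 5, Phi 5 1 t a 0 = 0 := by
  decide

end Summit.ResolutionOfSingularities.ResolutionOfSingularities.Theorems.SoloBlind
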